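import Summits.Ventures.LatticeQCDFlow.Scaling.TouchChainCover
import Summits.Ventures.LatticeQCDFlow.Scaling.HubCollectorLaw

/-!
HONEST FRAMING: exact (Metropolis-corrected) sampling algorithms for lattice gauge theory; figures
of merit are autocorrelation/cost numbers at stated couplings and volumes; no continuum-physics
claim.

# HubCoverTime — WHEN HAS EVERY COLD REPLICA BEEN OFFERED A SWAP?  ON A HUB LIST WITH EVERY HUB EDGE LISTED `≥ c`
# TIMES, THE PROPOSAL SCHEDULE HAS TOUCHED EVERY COLD LEVEL BY TIME `n` EXCEPT WITH PROBABILITY `≤ K·e^{−n·t·c/m}`,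
# I.E. `≤ e^{−a}` AFTER `n ≥ (m/(t·c))·(log K + a)` STEPS — THE COVER TIME OF THE SCHEDULE IS THE COUPON-COLLECTOR
# TIME, MATCHING THE ORDER OF THE MIXING FLOOR OF `Scaling/HubCollectorLaw` (lean-2 GEN-24, ours)

Venture-side (OURS).  Cell `lqcd-flow` (pub-lqcd), unit `pub-lqcd-lean-2-g24`, 2026-08-27.  Chapter L (the coupon-collector
law from a cold start), file 11: `Scaling/TouchChainCover` instantiated on the schedule of the hub-list exchange scheme
(`e_r = (0, κ_r + 1)`, swap fraction `t`, allocation `w`; the touch chain of `Scaling/ExchangeSchemeCollector`'s mixture,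
whose cold touch rates are `θ_{k+1} = t·c_k/m + (1−t)·w_{k+1} ≥ t·c/m` when `c ≤ c_k`).  The event bounded is
"some cold level has not yet been drawn, neither as a swap endpoint nor for an update" — a property of the random
schedule alone, the same for every maps, laws and kernels.

## What is proved

* `hubSchedule_touchRate_ge` (`θ_{k+1} ≥ t·c/m`), `hubSchedule_touchRate_cold` (the abstract rate at a cold level in
  closed form).
* **`hubSchedule_uncovered_le_exp`** — from `T` = the cold levels, `(δ_T Rⁿ){V ≠ ∅} ≤ K·e^{−n·t·c/m}` (`t·c ≤ m`).
* **`hubSchedule_uncovered_le_of_ge_log` (THE COVER TIME OF THE SCHEDULE)** — `n ≥ (m/(t·c))·(log K + a)` ⇒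
  `(δ_T Rⁿ){V ≠ ∅} ≤ e^{−a}`; for the plain star (`m = K`, `c = 1`): `n ≥ (K/t)·(log K + a)` suffices
  (`star_uncovered_le_of_ge_log`).

Reading (no numerics implied): the schedule offers every cold replica a swap within `(m/(t·c))·log K` steps (plus
`a·m/(t·c)` for confidence `1 − e^{−a}`); `Scaling/HubCollectorLaw` says equilibrium cannot come sooner than order
`(K/θ_Σ)·log K`; for the plain hot-only star both are `(K/t)·log K`: the coupon-collector time is exactly when the last
cold replica is first offered fresh material.  Whether the sampler IS mixed by then depends on transport quality and
the hot sampler (chapter K's ceilings), not on the schedule.  NOT CLAIMED: any mixing-time ceiling.  Literature grade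
(cell rule): OWN COMPOSITION on KNOWN MECHANISM; nothing cited as a fact; no new bib keys.
-/

noncomputable section

open Finset Function
open Literature.Probability.MarkovChains

namespace Summit.Ventures.LatticeQCDFlow.Scaling

variable {K m : ℕ} {w : Fin (K + 1) → ℝ} {t : ℝ}

section HubSchedule
variable (κ : Fin m → Fin K)

/-- The abstract touch rate of the cold level `k+1` under the hub schedule, in closed form:
`θ_{k+1} = t·c_k/m + (1−t)·w_{k+1}`. [ours] -/
theorem hubSchedule_touchRate_cold (k : Fin K) :
    ∑ a ∈ univ.filter (fun a : Fin m ⊕ Fin (K + 1) => k.succ ∈ Sum.elim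
        (fun r => ({((fun r : Fin m => (((0 : Fin (K + 1)), (κ r).succ) : Fin (K + 1) × Fin (K + 1))) r).1,
          ((fun r : Fin m => (((0 : Fin (K + 1)), (κ r).succ) : Fin (K + 1) × Fin (K + 1))) r).2} : Finset (Fin (K + 1))))
        (fun j => {j}) a),
      Sum.elim (fun _ : Fin m => t / m) (fun j => (1 - t) * w j) a
      = t * ((univ.filter (fun r : Fin m => κ r = k)).card : ℝ) / m + (1 - t) * w k.succ := by
  rw [exchangeScheme_touchRate, hubList_degree_succ κ k]

/-- **`θ_{k+1} ≥ t·c/m`** when the hub edge `(0, k+1)` is listed at least `c` times (`t, 1−t, w ≥ 0`). [ours] -/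
theorem hubSchedule_touchRate_ge (hm : 1 ≤ m) (hw0 : ∀ k, 0 ≤ w k) (ht0 : 0 ≤ t) (ht1 : t ≤ 1) {c : ℕ}
    (hc : ∀ k : Fin K, c ≤ (univ.filter (fun r : Fin m => κ r = k)).card) (k : Fin K) :
    t * c / m ≤ t * ((univ.filter (fun r : Fin m => κ r = k)).card : ℝ) / m + (1 - t) * w k.succ := by
  have hmpos : (0 : ℝ) < m := Nat.cast_pos.mpr (by omega)
  have hck : (c : ℝ) ≤ (univ.filter (fun r : Fin m => κ r = k)).card := by exact_mod_cast hc k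
  have h1 : t * c / m ≤ t * ((univ.filter (fun r : Fin m => κ r = k)).card : ℝ) / m :=
    div_le_div_of_nonneg_right (mul_le_mul_of_nonneg_left hck ht0) hmpos.le
  nlinarith [hw0 k.succ]

/-- **`(δ_T Rⁿ){V ≠ ∅} ≤ K·e^{−n·t·c/m}`** for the hub schedule from `T` = the cold levels (`t·c ≤ m`). [ours] -/
theorem hubSchedule_uncovered_le_exp (hm : 1 ≤ m) (hw0 : ∀ k, 0 ≤ w k) (hw1 : ∑ k, w k = 1) (ht0 : 0 ≤ t)
    (ht1 : t ≤ 1) {c : ℕ} (hc : ∀ k : Fin K, c ≤ (univ.filter (fun r : Fin m => κ r = k)).card) (hcm : t * c ≤ m)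
    {R : Finset (Fin (K + 1)) → Finset (Fin (K + 1)) → ℝ}
    (hR : ∀ U V, R U V = ∑ a : Fin m ⊕ Fin (K + 1), Sum.elim (fun _ : Fin m => t / m) (fun j => (1 - t) * w j) a *
      (if V = U \ Sum.elim
        (fun r => ({((fun r : Fin m => (((0 : Fin (K + 1)), (κ r).succ) : Fin (K + 1) × Fin (K + 1))) r).1,
          ((fun r : Fin m => (((0 : Fin (K + 1)), (κ r).succ) : Fin (K + 1) × Fin (K + 1))) r).2} : Finset (Fin (K + 1))))
        (fun j => {j}) a then (1 : ℝ) else 0)) (n : ℕ) :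
    ∑ V ∈ univ.filter (fun V : Finset (Fin (K + 1)) => V ≠ ∅),
        lawAt R (Pi.single ((univ : Finset (Fin K)).image Fin.succ) 1) n V
      ≤ (K : ℝ) * Real.exp (-(n * (t * c / m))) := by
  have hmpos : (0 : ℝ) < m := Nat.cast_pos.mpr (by omega)
  have hinj : Set.InjOn (Fin.succ : Fin K → Fin (K + 1)) ((univ : Finset (Fin K)) : Set (Fin K)) :=
    fun a _ b _ hab => Fin.succ_inj.mp hab
  have hTcard : (((univ : Finset (Fin K)).image Fin.succ).card : ℝ) = K := by
    rw [Finset.card_image_of_injOn hinj, card_univ, Fintype.card_fin]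
  have hθ : ∀ k ∈ (univ : Finset (Fin K)).image Fin.succ, t * c / m ≤
      ∑ a ∈ univ.filter (fun a : Fin m ⊕ Fin (K + 1) => k ∈ Sum.elim
        (fun r => ({((fun r : Fin m => (((0 : Fin (K + 1)), (κ r).succ) : Fin (K + 1) × Fin (K + 1))) r).1,
          ((fun r : Fin m => (((0 : Fin (K + 1)), (κ r).succ) : Fin (K + 1) × Fin (K + 1))) r).2} : Finset (Fin (K + 1))))
        (fun j => {j}) a),
      Sum.elim (fun _ : Fin m => t / m) (fun j => (1 - t) * w j) a := by
    intro k hk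
    rw [Finset.mem_image] at hk
    obtain ⟨j, -, rfl⟩ := hk
    rw [hubSchedule_touchRate_cold κ j]
    exact hubSchedule_touchRate_ge κ hm hw0 ht0 ht1 hc j
  have h := touch_lawAt_nonempty_le_exp (exchangeScheme_weights_nonneg (m := m) hw0 ht0 ht1)
    (exchangeScheme_weights_sum (t := t) hm hw1) hR ((univ : Finset (Fin K)).image Fin.succ)
    (θ := t * c / m) ((div_le_one hmpos).mpr hcm) hθ n
  rw [hTcard] at h
  exact h

/-- **THE COVER TIME OF THE SCHEDULE:** `K ≥ 1`, `0 < t`, `1 ≤ c`, `t·c ≤ m`, `n ≥ (m/(t·c))·(log K + a)` ⇒ the hub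
schedule has drawn every cold level by time `n` except with probability `≤ e^{−a}`. [ours] -/
theorem hubSchedule_uncovered_le_of_ge_log (hK : 1 ≤ K) (hm : 1 ≤ m) (hw0 : ∀ k, 0 ≤ w k) (hw1 : ∑ k, w k = 1)
    (ht0 : 0 < t) (ht1 : t ≤ 1) {c : ℕ} (hc1 : 1 ≤ c) (hc : ∀ k : Fin K, c ≤ (univ.filter (fun r : Fin m => κ r = k)).card)
    (hcm : t * c ≤ m) {R : Finset (Fin (K + 1)) → Finset (Fin (K + 1)) → ℝ}
    (hR : ∀ U V, R U V = ∑ a : Fin m ⊕ Fin (K + 1), Sum.elim (fun _ : Fin m => t / m) (fun j => (1 - t) * w j) a *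
      (if V = U \ Sum.elim
        (fun r => ({((fun r : Fin m => (((0 : Fin (K + 1)), (κ r).succ) : Fin (K + 1) × Fin (K + 1))) r).1,
          ((fun r : Fin m => (((0 : Fin (K + 1)), (κ r).succ) : Fin (K + 1) × Fin (K + 1))) r).2} : Finset (Fin (K + 1))))
        (fun j => {j}) a then (1 : ℝ) else 0)) {a : ℝ} {n : ℕ}
    (hn : (m : ℝ) / (t * c) * (Real.log K + a) ≤ n) :
    ∑ V ∈ univ.filter (fun V : Finset (Fin (K + 1)) => V ≠ ∅),
        lawAt R (Pi.single ((univ : Finset (Fin K)).image Fin.succ) 1) n V ≤ Real.exp (-a) := by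
  have hmpos : (0 : ℝ) < m := Nat.cast_pos.mpr (by omega)
  have hKpos : (0 : ℝ) < K := Nat.cast_pos.mpr (by omega)
  have hcpos : (0 : ℝ) < c := Nat.cast_pos.mpr (by omega)
  have hθpos : 0 < t * c / m := by positivity
  have hnθ : Real.log K + a ≤ n * (t * c / m) := by
    have h := mul_le_mul_of_nonneg_right hn hθpos.le
    have e : (m : ℝ) / (t * c) * (Real.log K + a) * (t * c / m) = Real.log K + a := by
      field_simp
    linarith [e]
  refine (hubSchedule_uncovered_le_exp κ hm hw0 hw1 ht0.le ht1 hc hcm hR n).trans ?_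
  rw [← Real.exp_log hKpos, ← Real.exp_add]
  exact Real.exp_le_exp.mpr (by linarith)

/-- **THE PLAIN STAR (`m = K`, every hub edge once): `n ≥ (K/t)·(log K + a)` ⇒ uncovered probability `≤ e^{−a}`.**
[ours] -/
theorem star_uncovered_le_of_ge_log (hK : 1 ≤ K) (hw0 : ∀ k, 0 ≤ w k) (hw1 : ∑ k, w k = 1) (ht0 : 0 < t) (ht1 : t ≤ 1)
    {R : Finset (Fin (K + 1)) → Finset (Fin (K + 1)) → ℝ}
    (hR : ∀ U V, R U V = ∑ a : Fin K ⊕ Fin (K + 1), Sum.elim (fun _ : Fin K => t / K) (fun j => (1 - t) * w j) a *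
      (if V = U \ Sum.elim
        (fun r => ({((fun r : Fin K => (((0 : Fin (K + 1)), r.succ) : Fin (K + 1) × Fin (K + 1))) r).1,
          ((fun r : Fin K => (((0 : Fin (K + 1)), r.succ) : Fin (K + 1) × Fin (K + 1))) r).2} : Finset (Fin (K + 1))))
        (fun j => {j}) a then (1 : ℝ) else 0)) {a : ℝ} {n : ℕ}
    (hn : (K : ℝ) / t * (Real.log K + a) ≤ n) :
    ∑ V ∈ univ.filter (fun V : Finset (Fin (K + 1)) => V ≠ ∅),
        lawAt R (Pi.single ((univ : Finset (Fin K)).image Fin.succ) 1) n V ≤ Real.exp (-a) := by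
  have hc : ∀ k : Fin K, 1 ≤ (univ.filter (fun r : Fin K => (id r) = k)).card := fun k =>
    Finset.card_pos.mpr ⟨k, Finset.mem_filter.mpr ⟨mem_univ _, rfl⟩⟩
  have hcm : t * ((1 : ℕ) : ℝ) ≤ K := by
    rw [Nat.cast_one, mul_one]; exact ht1.trans (by exact_mod_cast hK)
  have h := hubSchedule_uncovered_le_of_ge_log (κ := id) (w := w) hK hK hw0 hw1 ht0 ht1 (le_refl 1) hc hcm hR (a := a)
    (n := n) (by rw [Nat.cast_one, mul_one]; exact hn)
  exact h

end HubSchedule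

end Summit.Ventures.LatticeQCDFlow.Scaling

end
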